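/-
Copyright (c) 2026 the pub-hodgecm-mathlib formalisation cell (harness21).  Prover seat hodgecm-mathlib-K2Liu-p27 (g2), Track B «K2-LIT»,
#184♮ = hLiu418 = `stmt-HodgeConjecture-24832`; RULING M-158u, F4 (G-gen) road (E): brick (E-d-P-fin) = THE SEE-SAW PIVOT AT THE BIG CM DATUM, modulo the
right-leg group identity (R-grp) by value (F4 lead K2Liu-p27; desk word 2026-09-04T23:42:50Z (π0)–(π3)).
THEOREMS ONLY (no `def`, no `instance`, no notation, no named-fact hypothesis, no `sorry`); lane `--supports stmt-HodgeConjecture-24832 --as helper`.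
-/
import Summits.HodgeConjecture.HodgeConjecture.Theorems.K2LiuArchRightLegPlacePin         -- ★ (P-arch) (LH7-p07): `exists_clm_swSection_mul_placeSecJ_kH_eq`
import Summits.HodgeConjecture.HodgeConjecture.Theorems.K2LiuPartnerEmbeddingSWLaw         -- ★ SW-law (K2Liu-p02): `swSectionTensor_omega_partnerEmb_eq_mul`
import Summits.HodgeConjecture.HodgeConjecture.Theorems.K2LiuWittLineUnitaryEmbedding      -- ★ (K2E3-p25): `siegelDeltaCharacter_partnerEmb`
import Summits.HodgeConjecture.HodgeConjecture.Theorems.K2LiuRightLegVacuumScalarMatch     -- ★ (R-scal) (K2Liu-p26): `chi_pow_infiniteIdeles_eq_etaD_mul_vacScalar`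
import Summits.HodgeConjecture.HodgeConjecture.Theorems.K2LiuSiegelWeilSectionKFinite      -- ★ `swSection_mul_right`
import Summits.HodgeConjecture.HodgeConjecture.Theorems.K2LiuArchSWDataInductionCore       -- ★ B3 core ED. 3 (K2Liu-p27): `pivot_of_archPin_of_siegel`
import HarnessLib

/-!
# Crux `HLiu418`, organ F4 (G-gen), road (E), brick (E-d-P-fin): THE SEE-SAW PIVOT `SW_σ(κOp (1,k) Φ₁) = vacScalar (1,k) · SW_σ(Φ₁)` AT THE BIG CM DATUM,
# modulo the right-leg group identity (R-grp) by value

Cell `hodgecm-mathlib`, crux item hLiu418 = `stmt-HodgeConjecture-24832` (helper lane `--supports`, count-neutral; closes no socket).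

THE CHAIN (π0)–(π3) (F4 desk word 2026-09-04T23:42:50Z), typed once at the doubled CM datum `𝕎 = 𝔻 ⊗ V′` of ★ (P-arch): for `k = (c,d) ∈ K_H = U(R) × U(S)`, a finite
vector `f`, `h ∈ U(𝔻)(𝔸)`, and arch data `a, a′` whose junction readings at `σ` are `(e_* Φ₁) ⊠ Φ₂` and `(e_* (κOp (1,k) Φ₁)) ⊠ Φ₂`:
`f_{E(a′ ⊗ f)}(h ⊗ 1) = vacScalar ⟨−|S|,−|R|,−|Q|,−|P|⟩ (1,k) · f_{E(a ⊗ f)}(h ⊗ 1)`.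
(π0) ★ (P-arch) `K2LiuArchRightLegPlacePin.exists_clm_swSection_mul_placeSecJ_kH_eq` (one functional `ℓ′`, at `k` and at `k = 1`); (π1) (R-grp) BY VALUE: `hkk :
partnerEmb (kk k) = archEmb (placeSecJ σ (toBig (κ (1,k)), 1))` and the determinant datum `hdet : det (kk k) = (x_k, 1)` with `x_k` the `w(σ)`-single infinite idele of
`det c · det d` (`hxσ`, `hx`) — owners K2E3-p31 (g2) ∕ K2E3-p25 (g4), `Theorems/K2LiuArchPlaceSecJPartnerEmb.lean`; (π2) ★ `K2LiuSiegelWeilSectionKFinite.swSection_mul_right` +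
★ `K2LiuPartnerEmbeddingSWLaw.swSectionTensor_omega_partnerEmb_eq_mul`; (π3) ★ `K2LiuWittLineUnitaryEmbedding.siegelDeltaCharacter_partnerEmb` + ★ (R-scal)
`K2LiuRightLegVacuumScalarMatch.chi_pow_infiniteIdeles_eq_etaD_mul_vacScalar` (`|P| = |Q| = n`); glued by ★ `K2LiuArchSWDataInductionCore.pivot_of_archPin_of_siegel`.
* **`swSection_junctionSlot_κOp_eq_vacScalar_mul`** — the statement above.  With B3-b FILE 1's σ-slot reading (`K2LiuArchSWDataTuplesDefs.frame_tupleVec_eq_tensorPi`,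
  LH7-p07) and `funext h` it is the letter `hpiv σ rest` of ★ `K2LiuArchSWPlaceCyclic.fock_induction_of_blockFFT_of_pivot` ∕ ★ `K2LiuLocalThetaReduction.hRED_of_pivot`.
References: [KudlaRallis1994, §1]; [HarrisKudlaSweet1996, §1 (1.15)–(1.17)]; [KonnoKonno2007, Lemma 5.2]; [Folland1989, Prop. (4.39)]; [Paul1998, §1.2].
HONEST LABEL: HC_CM is proved only modulo the 7 printed citations (2 remaining named inputs: hLiu418 = stmt-HodgeConjecture-24832,
h413 = stmt-HodgeConjecture-24833) until rung 0 closes; count-neutral helper, closes no socket.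
-/

set_option autoImplicit false
set_option linter.dupNamespace false -- the mandated namespace repeats `HodgeConjecture.HodgeConjecture`
set_option synthInstance.maxSize 512 -- `DecidableEq` of the nested block index `DPIdx ((P×R)⊕(Q×S)) ((P×S)⊕(Q×R)) Unit Empty` (structural; as ★ (P-arch))

noncomputable section

open scoped Classical Matrix TensorProduct Kronecker SchwartzMap
open NumberField NumberField.InfinitePlace NumberField.mixedEmbedding IsDedekindDomain
open Literature.Analysis.SegalBargmann Literature.RepresentationTheory.HeisenbergGroup
open Literature.NumberTheory.Automorphic Literature.NumberTheory.Automorphic.UnitaryGroup Literature.NumberTheory.GaloisRepresentations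
open Literature.NumberTheory.Weil1964 Literature.NumberTheory.Weil1964.MpS Literature.NumberTheory.Weil1964.UnitaryWeil
open Literature.RepresentationTheory.HarrisKudlaSweet1996
open Literature.RepresentationTheory.KonnoKonno2007 Literature.RepresentationTheory.KonnoKonno2007.RealDualPair
open Literature.NumberTheory.GelbartRogawski1991 Literature.NumberTheory.GelbartRogawski1991.GRConstruction
open Literature.NumberTheory.GelbartRogawski1991.UnitaryDualPair
open Literature.NumberTheory.GelbartRogawski1991.UnitaryDualPair.LocalSplitting
open Literature.NumberTheory.K2Lit.SiegelDoubled
open Summit.HodgeConjecture.HodgeConjecture.Cruxes.HLiu418.K2LiuArchSectionPlaceBlock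
open Summit.HodgeConjecture.HodgeConjecture.Cruxes.HLiu418 (K2LiuArchOneParameterOrbitDefs.archEmb)
open Summit.HodgeConjecture.HodgeConjecture.Cruxes.HLiu418.K2LiuSwSectionArchOrbit
open Summit.HodgeConjecture.HodgeConjecture.Cruxes.HLiu418.K2LiuWeilSeesawRelabel
open Summit.HodgeConjecture.HodgeConjecture.Cruxes.HLiu418.K2LiuArchWeilJunctionTransport
open Summit.HodgeConjecture.HodgeConjecture.Cruxes.HLiu418.K2LiuArchRightLegPlacePin
open Summit.HodgeConjecture.HodgeConjecture.Cruxes.HLiu418.K2LiuPartnerEmbedding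
open Summit.HodgeConjecture.HodgeConjecture.Cruxes.HLiu418.K2LiuPartnerEmbeddingSWLaw
open Summit.HodgeConjecture.HodgeConjecture.Cruxes.HLiu418.K2LiuWittLineUnitaryEmbedding
open Summit.HodgeConjecture.HodgeConjecture.Cruxes.HLiu418.K2LiuRightLegVacuumScalarMatch
open Summit.HodgeConjecture.HodgeConjecture.Cruxes.HLiu418.K2LiuSiegelWeilSectionKFinite
open Summit.HodgeConjecture.HodgeConjecture.Cruxes.HLiu418.K2LiuArchSWDataInductionCore

namespace Summit.HodgeConjecture.HodgeConjecture.Cruxes.HLiu418.K2LiuArchSWPivotOfRecord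

variable (L : Type) [Field L] [NumberField L] [IsCMField L]
variable {N M n : ℕ} (e : Fin N × Fin M ≃ Fin n)
  (dV : Fin N → L) (hdV : ∀ i, IsCMField.complexConj L (dV i) = dV i) (hdV0 : ∀ i, dV i ≠ 0)
  (dW : Fin M → L) (hdW : ∀ i, IsCMField.complexConj L (dW i) = dW i) (hdW0 : ∀ i, dW i ≠ 0)
variable {M₂ M' n' : ℕ} (eW : Fin M × Fin M₂ ≃ Fin M') (e' : Fin N × Fin M' ≃ Fin n')
  (dV' : Fin M₂ → L) (hdV' : ∀ k, IsCMField.complexConj L (dV' k) = dV' k) (hdV'0 : ∀ k, dV' k ≠ 0)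
variable (σ : {v : InfinitePlace (Fp L) // v.IsReal})
  {P Q R S : Type} [Fintype P] [DecidableEq P] [Fintype Q] [DecidableEq Q] [Fintype R] [DecidableEq R] [Fintype S] [DecidableEq S]
  (eP : PosIdx (signVec (cmPlaceOver L) (fun k => Sum.elim (cmGramEntry L e' dV hdV (tensorFrame L dW eW dV') (tensorFrame_real L dW hdW eW dV' hdV')) (-cmGramEntry L e' dV hdV (tensorFrame L dW eW dV') (tensorFrame_real L dW hdW eW dV' hdV')) ((LocalSplitting.e₂ n').symm k)) (imagUnit L) σ) ≃ (P × R) ⊕ (Q × S))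
  (eQ : NegIdx (signVec (cmPlaceOver L) (fun k => Sum.elim (cmGramEntry L e' dV hdV (tensorFrame L dW eW dV') (tensorFrame_real L dW hdW eW dV' hdV')) (-cmGramEntry L e' dV hdV (tensorFrame L dW eW dV') (tensorFrame_real L dW hdW eW dV' hdV')) ((LocalSplitting.e₂ n').symm k)) (imagUnit L) σ) ≃ (P × S) ⊕ (Q × R))

-- the doubled metaplectic carrier of the big datum and the CM sign frame elaborate slowly (★ (P-arch) ∕ ★ J2c: 4 000 000 heartbeats for the statement)
set_option maxHeartbeats 4000000 in
/-- **(E-d-P-fin) THE SEE-SAW PIVOT AT THE BIG CM DATUM, modulo (R-grp) by value**: for a `χ`-normalised doubled Weil representation `sB` of `𝕎 = 𝔻 ⊗ V′`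
(`χ` unitary, splitting, of odd unitary archimedean type `(t,0)`; `|P| = |Q| = n`), right-leg partner data `kk k ∈ U(V′)(𝔸)` with
`partnerEmb (kk k) = archEmb (placeSecJ σ (toBig (κ (1,k)), 1))` and `det (kk k) = (x_k, 1)`, `x_k` the `w(σ)`-single infinite idele of `det c · det d`, a finite
vector `f`, `h ∈ U(𝔻)(𝔸)`, `k ∈ U(R) × U(S)`, and arch data `a, a′` with junction readings `𝒥 a = (e_* Φ₁) ⊠ Φ₂`, `𝒥 a′ = (e_* (κOp R S ⟨−|S|,−|R|,−|Q|,−|P|⟩ (1,k) Φ₁)) ⊠ Φ₂`: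
`f_{E(a′ ⊗ f)}(h ⊗ 1) = vacScalar ⟨−|S|,−|R|,−|Q|,−|P|⟩ (1,k) · f_{E(a ⊗ f)}(h ⊗ 1)` — ★ `pivot_of_archPin_of_siegel` at (π0) ★ (P-arch), (π2) ★ `swSection_mul_right` +
★ SW-law, (π3) ★ `siegelDeltaCharacter_partnerEmb` + ★ (R-scal).
[cite: KudlaRallis1994, §1] [cite: HarrisKudlaSweet1996, §1 (1.15)–(1.17)] [cite: KonnoKonno2007, Lemma 5.2 p. 73] [cite: Folland1989, §4.2 Prop. (4.39)] -/
theorem swSection_junctionSlot_κOp_eq_vacScalar_mul {χ : HeckeCharacter L} (hχu : χ.IsUnitary) (hχs : IsSplittingChar L 1 χ)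
    {sB : HA L e' dV hdV (tensorFrame L dW eW dV') (tensorFrame_real L dW hdW eW dV' hdV') →*
      MpD L e' dV hdV (tensorFrame L dW eW dV') (tensorFrame_real L dW hdW eW dV' hdV')}
    (hsB : IsDoubledWeilRep L e' dV hdV hdV0 (tensorFrame L dW eW dV') (tensorFrame_real L dW hdW eW dV' hdV')
      (tensorFrame_ne_zero L dW eW dV' hdW0 hdV'0) χ sB)
    {t : InfinitePlace L → ℤ} (ht : χ.HasUnitaryArchType t 0) (hodd : ∀ w, Odd (t w))
    (hPn : Fintype.card P = n) (hQn : Fintype.card Q = n)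
    (kk : Matrix.unitaryGroup R ℂ × Matrix.unitaryGroup S ℂ → UnitaryGroup.adelic (Fp L) L (IsCMField.complexConj L) M₂ (Matrix.diagonal dV'))
    (hkk : ∀ k : Matrix.unitaryGroup R ℂ × Matrix.unitaryGroup S ℂ,
      partnerEmb L e dV hdV dW hdW eW e' dV' hdV' (kk k) =
        K2LiuArchOneParameterOrbitDefs.archEmb (Fp L) L (IsCMField.complexConj L) (n' + n')
              (hermD L e' dV hdV (tensorFrame L dW eW dV') (tensorFrame_real L dW hdW eW dV' hdV'))
              (placeSecJ L (IsCMField.complexConj L) (n' + n') (IsCMField.complexConj_ne_one L) (cmPlaceOver L) (cmPlaceOver_smul L) _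
                (gramD_gram_realDiagonal_entry_ne_zero L e' dV hdV (tensorFrame L dW eW dV') (tensorFrame_real L dW hdW eW dV' hdV') hdV0 (tensorFrame_ne_zero L dW eW dV' hdW0 hdV'0)) (complexConj_imagUnit L) (imagUnit_ne_zero L) σ
                (cmPlaceOver_comap L) (gramD_eq_diagonal_cm L e' dV hdV (tensorFrame L dW eW dV') (tensorFrame_real L dW hdW eW dV' hdV')) (J := hermD L e' dV hdV (tensorFrame L dW eW dV') (tensorFrame_real L dW hdW eW dV' hdV')) rfl
                (complexConj_smul_infinitePlace L) eP eQ ((toBig P Q R S (κ P Q R S ((1 : Matrix.unitaryGroup P ℂ × Matrix.unitaryGroup Q ℂ), k)), (1 : UForm Unit Empty)) : Ginf ((P × R) ⊕ (Q × S)) ((P × S) ⊕ (Q × R)) Unit Empty)))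
    (xx : Matrix.unitaryGroup R ℂ × Matrix.unitaryGroup S ℂ → (InfiniteAdeleRing L)ˣ)
    (hdet : ∀ k : Matrix.unitaryGroup R ℂ × Matrix.unitaryGroup S ℂ,
      Matrix.GeneralLinearGroup.det ((kk k : UnitaryGroup.adelic (Fp L) L (IsCMField.complexConj L) M₂ (Matrix.diagonal dV')) :
        GL (Fin M₂) (AdeleRing (𝓞 L) L)) = infiniteIdeles L (xx k))
    (hxσ : ∀ k : Matrix.unitaryGroup R ℂ × Matrix.unitaryGroup S ℂ,
      InfinitePlace.Completion.extensionEmbedding (cmPlaceOver L σ).1 ((xx k : InfiniteAdeleRing L) (cmPlaceOver L σ).1) =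
        (k.1 : Matrix R R ℂ).det * (k.2 : Matrix S S ℂ).det)
    (hx : ∀ (k : Matrix.unitaryGroup R ℂ × Matrix.unitaryGroup S ℂ) (w : InfinitePlace L), w ≠ (cmPlaceOver L σ).1 →
      InfinitePlace.Completion.extensionEmbedding w ((xx k : InfiniteAdeleRing L) w) = 1)
    (f : FinSB (Fp L) (Fin (n' + n'))) (h : HA L e dV hdV dW hdW)
    (k : Matrix.unitaryGroup R ℂ × Matrix.unitaryGroup S ℂ) (Φ₁ : 𝓢((DPIdx P Q R S → ℝ), ℂ))
    (Φ₂ : 𝓢(((Fin (n' + n') × {v : {v : InfinitePlace (Fp L) // v.IsReal} // v ≠ σ}) → ℝ), ℂ))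
    (a a' : 𝓢((Fin (n' + n') → mixedSpace (Fp L)), ℂ))
    (ha : ((((schwartzTransport
                  (scaledFrame (Fp L) (Fin (n' + n'))
                    (placeScale (n' + n') fun v => sqrtAbs (signVec (cmPlaceOver L)
                      (fun k => Sum.elim (cmGramEntry L e' dV hdV (tensorFrame L dW eW dV') (tensorFrame_real L dW hdW eW dV' hdV')) (-cmGramEntry L e' dV hdV (tensorFrame L dW eW dV') (tensorFrame_real L dW hdW eW dV' hdV')) ((LocalSplitting.e₂ n').symm k))
                      (imagUnit L) v))
                    (placeScale_ne_zero (n' + n') (sqrtAbs_signVec_ne_zero (IsCMField.complexConj_ne_one L) (cmPlaceOver_smul L)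
                      (complexConj_imagUnit L) (imagUnit_ne_zero L) (gramD_gram_realDiagonal_entry_ne_zero L e' dV hdV (tensorFrame L dW eW dV') (tensorFrame_real L dW hdW eW dV' hdV') hdV0 (tensorFrame_ne_zero L dW eW dV' hdW0 hdV'0)))))).trans
                (schwartzTransport (reindexCLE (placeSplitEquiv (signSplit (signVec (cmPlaceOver L)
                  (fun k => Sum.elim (cmGramEntry L e' dV hdV (tensorFrame L dW eW dV') (tensorFrame_real L dW hdW eW dV' hdV')) (-cmGramEntry L e' dV hdV (tensorFrame L dW eW dV') (tensorFrame_real L dW hdW eW dV' hdV')) ((LocalSplitting.e₂ n').symm k))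
                  (imagUnit L) σ)) σ)))).trans
                (schwartzTransport (reindexCLE (Equiv.sumCongr
                  (unitJunctionIdx
                    (PosIdx (signVec (cmPlaceOver L)
                      (fun k => Sum.elim (cmGramEntry L e' dV hdV (tensorFrame L dW eW dV') (tensorFrame_real L dW hdW eW dV' hdV')) (-cmGramEntry L e' dV hdV (tensorFrame L dW eW dV') (tensorFrame_real L dW hdW eW dV' hdV')) ((LocalSplitting.e₂ n').symm k))
                      (imagUnit L) σ))
                    (NegIdx (signVec (cmPlaceOver L)
                      (fun k => Sum.elim (cmGramEntry L e' dV hdV (tensorFrame L dW eW dV') (tensorFrame_real L dW hdW eW dV' hdV')) (-cmGramEntry L e' dV hdV (tensorFrame L dW eW dV') (tensorFrame_real L dW hdW eW dV' hdV')) ((LocalSplitting.e₂ n').symm k))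
                      (imagUnit L) σ))).symm
                  (Equiv.refl (Fin (n' + n') × {v : {v : InfinitePlace (Fp L) // v.IsReal} // v ≠ σ})))))).trans
                (schwartzTransport (reindexCLE (Equiv.sumCongr
                  (dpIdxCongr
                    (PosIdx (signVec (cmPlaceOver L)
                      (fun k => Sum.elim (cmGramEntry L e' dV hdV (tensorFrame L dW eW dV') (tensorFrame_real L dW hdW eW dV' hdV')) (-cmGramEntry L e' dV hdV (tensorFrame L dW eW dV') (tensorFrame_real L dW hdW eW dV' hdV')) ((LocalSplitting.e₂ n').symm k))
                      (imagUnit L) σ))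
                    (NegIdx (signVec (cmPlaceOver L)
                      (fun k => Sum.elim (cmGramEntry L e' dV hdV (tensorFrame L dW eW dV') (tensorFrame_real L dW hdW eW dV' hdV')) (-cmGramEntry L e' dV hdV (tensorFrame L dW eW dV') (tensorFrame_real L dW hdW eW dV' hdV')) ((LocalSplitting.e₂ n').symm k))
                      (imagUnit L) σ))
                    Unit Empty ((P × R) ⊕ (Q × S)) ((P × S) ⊕ (Q × R)) Unit Empty eP eQ (Equiv.refl Unit) (Equiv.refl Empty)).symm
                  (Equiv.refl (Fin (n' + n') × {v : {v : InfinitePlace (Fp L) // v.IsReal} // v ≠ σ})))))) a = tensorPi ((schwartzTransport (reindexCLE (unitJunctionIdx ((P × R) ⊕ (Q × S)) ((P × S) ⊕ (Q × R))).symm)) Φ₁) Φ₂)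
    (ha' : ((((schwartzTransport
                  (scaledFrame (Fp L) (Fin (n' + n'))
                    (placeScale (n' + n') fun v => sqrtAbs (signVec (cmPlaceOver L)
                      (fun k => Sum.elim (cmGramEntry L e' dV hdV (tensorFrame L dW eW dV') (tensorFrame_real L dW hdW eW dV' hdV')) (-cmGramEntry L e' dV hdV (tensorFrame L dW eW dV') (tensorFrame_real L dW hdW eW dV' hdV')) ((LocalSplitting.e₂ n').symm k))
                      (imagUnit L) v))
                    (placeScale_ne_zero (n' + n') (sqrtAbs_signVec_ne_zero (IsCMField.complexConj_ne_one L) (cmPlaceOver_smul L)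
                      (complexConj_imagUnit L) (imagUnit_ne_zero L) (gramD_gram_realDiagonal_entry_ne_zero L e' dV hdV (tensorFrame L dW eW dV') (tensorFrame_real L dW hdW eW dV' hdV') hdV0 (tensorFrame_ne_zero L dW eW dV' hdW0 hdV'0)))))).trans
                (schwartzTransport (reindexCLE (placeSplitEquiv (signSplit (signVec (cmPlaceOver L)
                  (fun k => Sum.elim (cmGramEntry L e' dV hdV (tensorFrame L dW eW dV') (tensorFrame_real L dW hdW eW dV' hdV')) (-cmGramEntry L e' dV hdV (tensorFrame L dW eW dV') (tensorFrame_real L dW hdW eW dV' hdV')) ((LocalSplitting.e₂ n').symm k))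
                  (imagUnit L) σ)) σ)))).trans
                (schwartzTransport (reindexCLE (Equiv.sumCongr
                  (unitJunctionIdx
                    (PosIdx (signVec (cmPlaceOver L)
                      (fun k => Sum.elim (cmGramEntry L e' dV hdV (tensorFrame L dW eW dV') (tensorFrame_real L dW hdW eW dV' hdV')) (-cmGramEntry L e' dV hdV (tensorFrame L dW eW dV') (tensorFrame_real L dW hdW eW dV' hdV')) ((LocalSplitting.e₂ n').symm k))
                      (imagUnit L) σ))
                    (NegIdx (signVec (cmPlaceOver L)
                      (fun k => Sum.elim (cmGramEntry L e' dV hdV (tensorFrame L dW eW dV') (tensorFrame_real L dW hdW eW dV' hdV')) (-cmGramEntry L e' dV hdV (tensorFrame L dW eW dV') (tensorFrame_real L dW hdW eW dV' hdV')) ((LocalSplitting.e₂ n').symm k))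
                      (imagUnit L) σ))).symm
                  (Equiv.refl (Fin (n' + n') × {v : {v : InfinitePlace (Fp L) // v.IsReal} // v ≠ σ})))))).trans
                (schwartzTransport (reindexCLE (Equiv.sumCongr
                  (dpIdxCongr
                    (PosIdx (signVec (cmPlaceOver L)
                      (fun k => Sum.elim (cmGramEntry L e' dV hdV (tensorFrame L dW eW dV') (tensorFrame_real L dW hdW eW dV' hdV')) (-cmGramEntry L e' dV hdV (tensorFrame L dW eW dV') (tensorFrame_real L dW hdW eW dV' hdV')) ((LocalSplitting.e₂ n').symm k))
                      (imagUnit L) σ))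
                    (NegIdx (signVec (cmPlaceOver L)
                      (fun k => Sum.elim (cmGramEntry L e' dV hdV (tensorFrame L dW eW dV') (tensorFrame_real L dW hdW eW dV' hdV')) (-cmGramEntry L e' dV hdV (tensorFrame L dW eW dV') (tensorFrame_real L dW hdW eW dV' hdV')) ((LocalSplitting.e₂ n').symm k))
                      (imagUnit L) σ))
                    Unit Empty ((P × R) ⊕ (Q × S)) ((P × S) ⊕ (Q × R)) Unit Empty eP eQ (Equiv.refl Unit) (Equiv.refl Empty)).symm
                  (Equiv.refl (Fin (n' + n') × {v : {v : InfinitePlace (Fp L) // v.IsReal} // v ≠ σ})))))) a' =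
      tensorPi ((schwartzTransport (reindexCLE (unitJunctionIdx ((P × R) ⊕ (Q × S)) ((P × S) ⊕ (Q × R))).symm))
        (κOp R S (⟨-(Fintype.card S : ℤ), -(Fintype.card R : ℤ), -(Fintype.card Q : ℤ), -(Fintype.card P : ℤ)⟩ : VacExponents)
                (((1 : Matrix.unitaryGroup P ℂ × Matrix.unitaryGroup Q ℂ), k) : DPK P Q R S) Φ₁)) Φ₂) :
    swSection L e' dV hdV hdV0 (tensorFrame L dW eW dV') (tensorFrame_real L dW hdW eW dV' hdV') (tensorFrame_ne_zero L dW eW dV' hdW0 hdV'0) sB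
            (piSchwartzBruhatEquiv (Fp L) (Fin (n' + n')) (a' ⊗ₜ f))
            (tensorEmb L e dV hdV dW hdW eW e' dV' hdV' h) =
      vacScalar (⟨-(Fintype.card S : ℤ), -(Fintype.card R : ℤ), -(Fintype.card Q : ℤ), -(Fintype.card P : ℤ)⟩ : VacExponents) (((1 : Matrix.unitaryGroup P ℂ × Matrix.unitaryGroup Q ℂ), k) : DPK P Q R S) *
        swSection L e' dV hdV hdV0 (tensorFrame L dW eW dV') (tensorFrame_real L dW hdW eW dV' hdV') (tensorFrame_ne_zero L dW eW dV' hdW0 hdV'0) sB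
            (piSchwartzBruhatEquiv (Fp L) (Fin (n' + n')) (a ⊗ₜ f))
            (tensorEmb L e dV hdV dW hdW eW e' dV' hdV' h) := by
  -- (π0) the one-functional law of ★ (P-arch) at `H′ := h ⊗ 1`
  obtain ⟨ℓ', hℓ'⟩ := exists_clm_swSection_mul_placeSecJ_kH_eq L dV hdV hdV0 dW hdW hdW0 eW e' dV' hdV' hdV'0 σ eP eQ hχu hχs hsB ht hodd
    (tensorEmb L e dV hdV dW hdW eW e' dV' hdV' h) f
  -- normalisations at `k = 1`
  have hx1 : K2LiuArchOneParameterOrbitDefs.archEmb (Fp L) L (IsCMField.complexConj L) (n' + n')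
              (hermD L e' dV hdV (tensorFrame L dW eW dV') (tensorFrame_real L dW hdW eW dV' hdV'))
              (placeSecJ L (IsCMField.complexConj L) (n' + n') (IsCMField.complexConj_ne_one L) (cmPlaceOver L) (cmPlaceOver_smul L) _
                (gramD_gram_realDiagonal_entry_ne_zero L e' dV hdV (tensorFrame L dW eW dV') (tensorFrame_real L dW hdW eW dV' hdV') hdV0 (tensorFrame_ne_zero L dW eW dV' hdW0 hdV'0)) (complexConj_imagUnit L) (imagUnit_ne_zero L) σ
                (cmPlaceOver_comap L) (gramD_eq_diagonal_cm L e' dV hdV (tensorFrame L dW eW dV') (tensorFrame_real L dW hdW eW dV' hdV')) (J := hermD L e' dV hdV (tensorFrame L dW eW dV') (tensorFrame_real L dW hdW eW dV' hdV')) rfl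
                (complexConj_smul_infinitePlace L) eP eQ ((toBig P Q R S (κ P Q R S ((1 : Matrix.unitaryGroup P ℂ × Matrix.unitaryGroup Q ℂ), (1 : Matrix.unitaryGroup R ℂ × Matrix.unitaryGroup S ℂ))), (1 : UForm Unit Empty)) : Ginf ((P × R) ⊕ (Q × S)) ((P × S) ⊕ (Q × R)) Unit Empty)) = 1 := by
    simp only [Prod.mk_one_one, map_one]
  have hκ1 : ∀ Ψ : 𝓢((DPIdx P Q R S → ℝ), ℂ),
      κOp R S (⟨-(Fintype.card S : ℤ), -(Fintype.card R : ℤ), -(Fintype.card Q : ℤ), -(Fintype.card P : ℤ)⟩ : VacExponents)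
                (((1 : Matrix.unitaryGroup P ℂ × Matrix.unitaryGroup Q ℂ), (1 : Matrix.unitaryGroup R ℂ × Matrix.unitaryGroup S ℂ)) : DPK P Q R S) Ψ = Ψ := fun Ψ => by
    simp only [Prod.mk_one_one, κOp_one, ContinuousLinearMap.coe_id', id_eq]
  have hη1 : (((etaD L e' dV hdV (tensorFrame L dW eW dV') (tensorFrame_real L dW hdW eW dV' hdV') t
              (placeSecJ L (IsCMField.complexConj L) (n' + n') (IsCMField.complexConj_ne_one L) (cmPlaceOver L) (cmPlaceOver_smul L) _
                (gramD_gram_realDiagonal_entry_ne_zero L e' dV hdV (tensorFrame L dW eW dV') (tensorFrame_real L dW hdW eW dV' hdV') hdV0 (tensorFrame_ne_zero L dW eW dV' hdW0 hdV'0)) (complexConj_imagUnit L) (imagUnit_ne_zero L) σ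
                (cmPlaceOver_comap L) (gramD_eq_diagonal_cm L e' dV hdV (tensorFrame L dW eW dV') (tensorFrame_real L dW hdW eW dV' hdV')) (J := hermD L e' dV hdV (tensorFrame L dW eW dV') (tensorFrame_real L dW hdW eW dV' hdV')) rfl
                (complexConj_smul_infinitePlace L) eP eQ ((toBig P Q R S (κ P Q R S ((1 : Matrix.unitaryGroup P ℂ × Matrix.unitaryGroup Q ℂ), (1 : Matrix.unitaryGroup R ℂ × Matrix.unitaryGroup S ℂ))), (1 : UForm Unit Empty)) : Ginf ((P × R) ⊕ (Q × S)) ((P × S) ⊕ (Q × R)) Unit Empty)) : ℂˣ) : ℂ)) = 1 := by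
    simp only [Prod.mk_one_one, map_one, Units.val_one]
  have hη : ∀ k : Matrix.unitaryGroup R ℂ × Matrix.unitaryGroup S ℂ,
      (((etaD L e' dV hdV (tensorFrame L dW eW dV') (tensorFrame_real L dW hdW eW dV' hdV') t
              (placeSecJ L (IsCMField.complexConj L) (n' + n') (IsCMField.complexConj_ne_one L) (cmPlaceOver L) (cmPlaceOver_smul L) _
                (gramD_gram_realDiagonal_entry_ne_zero L e' dV hdV (tensorFrame L dW eW dV') (tensorFrame_real L dW hdW eW dV' hdV') hdV0 (tensorFrame_ne_zero L dW eW dV' hdW0 hdV'0)) (complexConj_imagUnit L) (imagUnit_ne_zero L) σ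
                (cmPlaceOver_comap L) (gramD_eq_diagonal_cm L e' dV hdV (tensorFrame L dW eW dV') (tensorFrame_real L dW hdW eW dV' hdV')) (J := hermD L e' dV hdV (tensorFrame L dW eW dV') (tensorFrame_real L dW hdW eW dV' hdV')) rfl
                (complexConj_smul_infinitePlace L) eP eQ ((toBig P Q R S (κ P Q R S ((1 : Matrix.unitaryGroup P ℂ × Matrix.unitaryGroup Q ℂ), k)), (1 : UForm Unit Empty)) : Ginf ((P × R) ⊕ (Q × S)) ((P × S) ⊕ (Q × R)) Unit Empty)) : ℂˣ) : ℂ)) ≠ 0 := fun k => Units.ne_zero _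
  -- (π1) + (π2): right translation by `archEmb (…) = partnerEmb (kk k)` is the character `χ′(partnerEmb (kk k))` on the section along `h ⊗ 1`
  have hq : ∀ (k : Matrix.unitaryGroup R ℂ × Matrix.unitaryGroup S ℂ) (b : 𝓢((Fin (n' + n') → mixedSpace (Fp L)), ℂ)),
      swSection L e' dV hdV hdV0 (tensorFrame L dW eW dV') (tensorFrame_real L dW hdW eW dV' hdV') (tensorFrame_ne_zero L dW eW dV' hdW0 hdV'0) sB
            (piSchwartzBruhatEquiv (Fp L) (Fin (n' + n')) (b ⊗ₜ f))
            (tensorEmb L e dV hdV dW hdW eW e' dV' hdV' h *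
              K2LiuArchOneParameterOrbitDefs.archEmb (Fp L) L (IsCMField.complexConj L) (n' + n')
              (hermD L e' dV hdV (tensorFrame L dW eW dV') (tensorFrame_real L dW hdW eW dV' hdV'))
              (placeSecJ L (IsCMField.complexConj L) (n' + n') (IsCMField.complexConj_ne_one L) (cmPlaceOver L) (cmPlaceOver_smul L) _
                (gramD_gram_realDiagonal_entry_ne_zero L e' dV hdV (tensorFrame L dW eW dV') (tensorFrame_real L dW hdW eW dV' hdV') hdV0 (tensorFrame_ne_zero L dW eW dV' hdW0 hdV'0)) (complexConj_imagUnit L) (imagUnit_ne_zero L) σ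
                (cmPlaceOver_comap L) (gramD_eq_diagonal_cm L e' dV hdV (tensorFrame L dW eW dV') (tensorFrame_real L dW hdW eW dV' hdV')) (J := hermD L e' dV hdV (tensorFrame L dW eW dV') (tensorFrame_real L dW hdW eW dV' hdV')) rfl
                (complexConj_smul_infinitePlace L) eP eQ ((toBig P Q R S (κ P Q R S ((1 : Matrix.unitaryGroup P ℂ × Matrix.unitaryGroup Q ℂ), k)), (1 : UForm Unit Empty)) : Ginf ((P × R) ⊕ (Q × S)) ((P × S) ⊕ (Q × R)) Unit Empty))) =
        siegelDeltaCharacter L e' dV hdV (tensorFrame L dW eW dV') (tensorFrame_real L dW hdW eW dV' hdV') χ ((1 - (n' : ℂ)) / 2)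
              (partnerEmb L e dV hdV dW hdW eW e' dV' hdV' (kk k)) *
          swSection L e' dV hdV hdV0 (tensorFrame L dW eW dV') (tensorFrame_real L dW hdW eW dV' hdV') (tensorFrame_ne_zero L dW eW dV' hdW0 hdV'0) sB
            (piSchwartzBruhatEquiv (Fp L) (Fin (n' + n')) (b ⊗ₜ f))
            (tensorEmb L e dV hdV dW hdW eW e' dV' hdV' h) := fun k b => by
    rw [← hkk k, swSection_mul_right]
    have hlaw := swSectionTensor_omega_partnerEmb_eq_mul L e dV hdV hdV0 dW hdW hdW0 eW e' dV' hdV' hdV'0 hsB (kk k)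
      (piSchwartzBruhatEquiv (Fp L) (Fin (n' + n')) (b ⊗ₜ f)) h
    rw [swSectionTensor_apply, swSectionTensor_apply] at hlaw
    exact hlaw
  -- (π3): the scalar match
  have hscal : ∀ k : Matrix.unitaryGroup R ℂ × Matrix.unitaryGroup S ℂ,
      siegelDeltaCharacter L e' dV hdV (tensorFrame L dW eW dV') (tensorFrame_real L dW hdW eW dV' hdV') χ ((1 - (n' : ℂ)) / 2)
              (partnerEmb L e dV hdV dW hdW eW e' dV' hdV' (kk k)) =
        (((etaD L e' dV hdV (tensorFrame L dW eW dV') (tensorFrame_real L dW hdW eW dV' hdV') t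
              (placeSecJ L (IsCMField.complexConj L) (n' + n') (IsCMField.complexConj_ne_one L) (cmPlaceOver L) (cmPlaceOver_smul L) _
                (gramD_gram_realDiagonal_entry_ne_zero L e' dV hdV (tensorFrame L dW eW dV') (tensorFrame_real L dW hdW eW dV' hdV') hdV0 (tensorFrame_ne_zero L dW eW dV' hdW0 hdV'0)) (complexConj_imagUnit L) (imagUnit_ne_zero L) σ
                (cmPlaceOver_comap L) (gramD_eq_diagonal_cm L e' dV hdV (tensorFrame L dW eW dV') (tensorFrame_real L dW hdW eW dV' hdV')) (J := hermD L e' dV hdV (tensorFrame L dW eW dV') (tensorFrame_real L dW hdW eW dV' hdV')) rfl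
                (complexConj_smul_infinitePlace L) eP eQ ((toBig P Q R S (κ P Q R S ((1 : Matrix.unitaryGroup P ℂ × Matrix.unitaryGroup Q ℂ), k)), (1 : UForm Unit Empty)) : Ginf ((P × R) ⊕ (Q × S)) ((P × S) ⊕ (Q × R)) Unit Empty)) : ℂˣ) : ℂ)) *
          vacScalar (⟨-(Fintype.card S : ℤ), -(Fintype.card R : ℤ), -(Fintype.card Q : ℤ), -(Fintype.card P : ℤ)⟩ : VacExponents) (((1 : Matrix.unitaryGroup P ℂ × Matrix.unitaryGroup Q ℂ), k) : DPK P Q R S) := fun k => by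
    rw [siegelDeltaCharacter_partnerEmb L e dV hdV dW hdW eW e' dV' hdV' hdV'0 χ _ (kk k), hdet k]
    exact chi_pow_infiniteIdeles_eq_etaD_mul_vacScalar L e' dV hdV hdV0 (tensorFrame L dW eW dV') (tensorFrame_real L dW hdW eW dV' hdV')
      (tensorFrame_ne_zero L dW eW dV' hdW0 hdV'0) σ eP eQ ht hodd n hPn hQn k (xx k) (hxσ k) (hx k)
  exact pivot_of_archPin_of_siegel
    (fun (b : 𝓢((Fin (n' + n') → mixedSpace (Fp L)), ℂ)) (g : HA L e' dV hdV (tensorFrame L dW eW dV') (tensorFrame_real L dW hdW eW dV' hdV')) =>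
      swSection L e' dV hdV hdV0 (tensorFrame L dW eW dV') (tensorFrame_real L dW hdW eW dV' hdV') (tensorFrame_ne_zero L dW eW dV' hdW0 hdV'0) sB
            (piSchwartzBruhatEquiv (Fp L) (Fin (n' + n')) (b ⊗ₜ f))
            (g))
    (fun b : 𝓢((Fin (n' + n') → mixedSpace (Fp L)), ℂ) =>
      ((((schwartzTransport
                  (scaledFrame (Fp L) (Fin (n' + n'))
                    (placeScale (n' + n') fun v => sqrtAbs (signVec (cmPlaceOver L)
                      (fun k => Sum.elim (cmGramEntry L e' dV hdV (tensorFrame L dW eW dV') (tensorFrame_real L dW hdW eW dV' hdV')) (-cmGramEntry L e' dV hdV (tensorFrame L dW eW dV') (tensorFrame_real L dW hdW eW dV' hdV')) ((LocalSplitting.e₂ n').symm k))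
                      (imagUnit L) v))
                    (placeScale_ne_zero (n' + n') (sqrtAbs_signVec_ne_zero (IsCMField.complexConj_ne_one L) (cmPlaceOver_smul L)
                      (complexConj_imagUnit L) (imagUnit_ne_zero L) (gramD_gram_realDiagonal_entry_ne_zero L e' dV hdV (tensorFrame L dW eW dV') (tensorFrame_real L dW hdW eW dV' hdV') hdV0 (tensorFrame_ne_zero L dW eW dV' hdW0 hdV'0)))))).trans
                (schwartzTransport (reindexCLE (placeSplitEquiv (signSplit (signVec (cmPlaceOver L)
                  (fun k => Sum.elim (cmGramEntry L e' dV hdV (tensorFrame L dW eW dV') (tensorFrame_real L dW hdW eW dV' hdV')) (-cmGramEntry L e' dV hdV (tensorFrame L dW eW dV') (tensorFrame_real L dW hdW eW dV' hdV')) ((LocalSplitting.e₂ n').symm k))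
                  (imagUnit L) σ)) σ)))).trans
                (schwartzTransport (reindexCLE (Equiv.sumCongr
                  (unitJunctionIdx
                    (PosIdx (signVec (cmPlaceOver L)
                      (fun k => Sum.elim (cmGramEntry L e' dV hdV (tensorFrame L dW eW dV') (tensorFrame_real L dW hdW eW dV' hdV')) (-cmGramEntry L e' dV hdV (tensorFrame L dW eW dV') (tensorFrame_real L dW hdW eW dV' hdV')) ((LocalSplitting.e₂ n').symm k))
                      (imagUnit L) σ))
                    (NegIdx (signVec (cmPlaceOver L)
                      (fun k => Sum.elim (cmGramEntry L e' dV hdV (tensorFrame L dW eW dV') (tensorFrame_real L dW hdW eW dV' hdV')) (-cmGramEntry L e' dV hdV (tensorFrame L dW eW dV') (tensorFrame_real L dW hdW eW dV' hdV')) ((LocalSplitting.e₂ n').symm k))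
                      (imagUnit L) σ))).symm
                  (Equiv.refl (Fin (n' + n') × {v : {v : InfinitePlace (Fp L) // v.IsReal} // v ≠ σ})))))).trans
                (schwartzTransport (reindexCLE (Equiv.sumCongr
                  (dpIdxCongr
                    (PosIdx (signVec (cmPlaceOver L)
                      (fun k => Sum.elim (cmGramEntry L e' dV hdV (tensorFrame L dW eW dV') (tensorFrame_real L dW hdW eW dV' hdV')) (-cmGramEntry L e' dV hdV (tensorFrame L dW eW dV') (tensorFrame_real L dW hdW eW dV' hdV')) ((LocalSplitting.e₂ n').symm k))
                      (imagUnit L) σ))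
                    (NegIdx (signVec (cmPlaceOver L)
                      (fun k => Sum.elim (cmGramEntry L e' dV hdV (tensorFrame L dW eW dV') (tensorFrame_real L dW hdW eW dV' hdV')) (-cmGramEntry L e' dV hdV (tensorFrame L dW eW dV') (tensorFrame_real L dW hdW eW dV' hdV')) ((LocalSplitting.e₂ n').symm k))
                      (imagUnit L) σ))
                    Unit Empty ((P × R) ⊕ (Q × S)) ((P × S) ⊕ (Q × R)) Unit Empty eP eQ (Equiv.refl Unit) (Equiv.refl Empty)).symm
                  (Equiv.refl (Fin (n' + n') × {v : {v : InfinitePlace (Fp L) // v.IsReal} // v ≠ σ})))))) b)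
    (fun (Ψ₁ : 𝓢((DPIdx P Q R S → ℝ), ℂ)) (Ψ₂ : 𝓢(((Fin (n' + n') × {v : {v : InfinitePlace (Fp L) // v.IsReal} // v ≠ σ}) → ℝ), ℂ)) =>
      tensorPi ((schwartzTransport (reindexCLE (unitJunctionIdx ((P × R) ⊕ (Q × S)) ((P × S) ⊕ (Q × R))).symm)) Ψ₁) Ψ₂)
    (fun k : Matrix.unitaryGroup R ℂ × Matrix.unitaryGroup S ℂ =>
      K2LiuArchOneParameterOrbitDefs.archEmb (Fp L) L (IsCMField.complexConj L) (n' + n')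
              (hermD L e' dV hdV (tensorFrame L dW eW dV') (tensorFrame_real L dW hdW eW dV' hdV'))
              (placeSecJ L (IsCMField.complexConj L) (n' + n') (IsCMField.complexConj_ne_one L) (cmPlaceOver L) (cmPlaceOver_smul L) _
                (gramD_gram_realDiagonal_entry_ne_zero L e' dV hdV (tensorFrame L dW eW dV') (tensorFrame_real L dW hdW eW dV' hdV') hdV0 (tensorFrame_ne_zero L dW eW dV' hdW0 hdV'0)) (complexConj_imagUnit L) (imagUnit_ne_zero L) σ
                (cmPlaceOver_comap L) (gramD_eq_diagonal_cm L e' dV hdV (tensorFrame L dW eW dV') (tensorFrame_real L dW hdW eW dV' hdV')) (J := hermD L e' dV hdV (tensorFrame L dW eW dV') (tensorFrame_real L dW hdW eW dV' hdV')) rfl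
                (complexConj_smul_infinitePlace L) eP eQ ((toBig P Q R S (κ P Q R S ((1 : Matrix.unitaryGroup P ℂ × Matrix.unitaryGroup Q ℂ), k)), (1 : UForm Unit Empty)) : Ginf ((P × R) ⊕ (Q × S)) ((P × S) ⊕ (Q × R)) Unit Empty)))
    (fun (k : Matrix.unitaryGroup R ℂ × Matrix.unitaryGroup S ℂ) (Ψ : 𝓢((DPIdx P Q R S → ℝ), ℂ)) =>
      κOp R S (⟨-(Fintype.card S : ℤ), -(Fintype.card R : ℤ), -(Fintype.card Q : ℤ), -(Fintype.card P : ℤ)⟩ : VacExponents)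
                (((1 : Matrix.unitaryGroup P ℂ × Matrix.unitaryGroup Q ℂ), k) : DPK P Q R S) Ψ)
    (fun k : Matrix.unitaryGroup R ℂ × Matrix.unitaryGroup S ℂ =>
      (((etaD L e' dV hdV (tensorFrame L dW eW dV') (tensorFrame_real L dW hdW eW dV' hdV') t
              (placeSecJ L (IsCMField.complexConj L) (n' + n') (IsCMField.complexConj_ne_one L) (cmPlaceOver L) (cmPlaceOver_smul L) _
                (gramD_gram_realDiagonal_entry_ne_zero L e' dV hdV (tensorFrame L dW eW dV') (tensorFrame_real L dW hdW eW dV' hdV') hdV0 (tensorFrame_ne_zero L dW eW dV' hdW0 hdV'0)) (complexConj_imagUnit L) (imagUnit_ne_zero L) σ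
                (cmPlaceOver_comap L) (gramD_eq_diagonal_cm L e' dV hdV (tensorFrame L dW eW dV') (tensorFrame_real L dW hdW eW dV' hdV')) (J := hermD L e' dV hdV (tensorFrame L dW eW dV') (tensorFrame_real L dW hdW eW dV' hdV')) rfl
                (complexConj_smul_infinitePlace L) eP eQ ((toBig P Q R S (κ P Q R S ((1 : Matrix.unitaryGroup P ℂ × Matrix.unitaryGroup Q ℂ), k)), (1 : UForm Unit Empty)) : Ginf ((P × R) ⊕ (Q × S)) ((P × S) ⊕ (Q × R)) Unit Empty)) : ℂˣ) : ℂ)))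
    (fun k : Matrix.unitaryGroup R ℂ × Matrix.unitaryGroup S ℂ =>
      siegelDeltaCharacter L e' dV hdV (tensorFrame L dW eW dV') (tensorFrame_real L dW hdW eW dV' hdV') χ ((1 - (n' : ℂ)) / 2)
              (partnerEmb L e dV hdV dW hdW eW e' dV' hdV' (kk k)))
    (fun k : Matrix.unitaryGroup R ℂ × Matrix.unitaryGroup S ℂ => vacScalar (⟨-(Fintype.card S : ℤ), -(Fintype.card R : ℤ), -(Fintype.card Q : ℤ), -(Fintype.card P : ℤ)⟩ : VacExponents) (((1 : Matrix.unitaryGroup P ℂ × Matrix.unitaryGroup Q ℂ), k) : DPK P Q R S))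
    (tensorEmb L e dV hdV dW hdW eW e' dV' hdV' h) (fun Ψ => ℓ' Ψ) hx1 hκ1 hη1 hη (fun k Ψ₁ Ψ₂ b hb => hℓ' k Ψ₁ Ψ₂ b hb) hq hscal k Φ₁ Φ₂ a a' ha ha'

end Summit.HodgeConjecture.HodgeConjecture.Cruxes.HLiu418.K2LiuArchSWPivotOfRecord

end
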